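import Summits.CriticalPhenomena.PercolationContinuityZ3.Theorems.Transplant.ProdTriHubRoute
import Summits.CriticalPhenomena.PercolationContinuityZ3.Theorems.Transplant.ProdTriFilmIso
import Summits.CriticalPhenomena.PercolationContinuityZ3.Theorems.Transplant.TriFilmSKFinalK1
import Summits.CriticalPhenomena.PercolationContinuityZ3.Theorems.Transplant.ProdZ2Route
import HarnessLib

/-!
# **`θ_{F □ 𝕋}(v, p_c(F □ 𝕋)) = 0` FOR EVERY FINITE CONNECTED GRAPH `F` AND EVERY VERTEX** — the TRIANGULAR-LATTICE twin of Duminil-Copin–Sidoravicius–Tassion's remark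
# "`ℤ² × G`, `G` finite", WITHOUT p205010: the uniform routing for fibres with a fork, the triangular films for the fork-free fibres, and the named fibres
# (`𝕋 × P_{k+1}`, `𝕋 × C_n`, `𝕋 × K_W`, `𝕋 × P_{a+1} × P_{b+1}`)

builds on p205010 (kernel theorem, internal audit signed; external expert review pending) — NOT used in this file.
Lane `prim-bschramm`, seat `prim-bschramm-p2` (gen 51; class C1b = films / other 3D lattices at their own critical point, METHOD = input substitution;
memo `HOME/bschramm/P2-LATTICES.md` §162); helper file (`--supports stmt-CriticalPhenomena-4575 --as helper`).  Hexagonal twin of «ProdZ2Route» (gen 50).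

THE ROW.  `𝕋 = triGraph` (the planar triangular lattice, six neighbours, NO quarter-turn symmetry); `F` any finite connected graph.  §1: for `F` with a FORK (a vertex with
two distinct neighbours: every connected `F` with `≥ 3` vertices) the column-level routing «ProdTriHexShadow».`ColRouting F` holds — every column-certified terminal triple
gets a planar hexagonal claw from the kernel table («TriClawXLegs».`exists_claw_of_tgtCols`; NO exceptional family in hexagonal geometry) and the hub template a swap
pair («ProdTriHubRoute») —, hence `θ(p_c) = 0` by the hexagonal DST layer with the exit-form routing («HexShadowVRoutingX», through «ProdTriHexShadow»).  §2: the
fork-free connected `F` are `P₁` (one vertex: `F □ 𝕋 ≅ 𝕋 × {0}`, Wierman's theorem, «TriFilmZero») and `P₂` (one edge: `F □ 𝕋 ≅ 𝕋 × {0,1}`, the kernel certificate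
«TriFilmSKFinalK1»), through «ProdTriFilmIso».`pathProdIsoFilm`.  §3: **`FinProdTri.theta_criticalProb_eq_zero`** (every finite connected `F`, every vertex of `F □ 𝕋`),
**`theta_criticalProb_eq_zero_comm`** (every vertex of `𝕋 □ F`), `continuous_theta` (van den Berg–Keane phrasing); §4 named fibres.
External input of the row beyond DST's method: NONE (kernel-checked hexagonal claw table of this generation; Burton–Keane; Wierman / the `𝕋 × {0,1}` certificate
for the two degenerate fibres).  In print: nothing for `𝕋 × G` (DST's remark is stated for `ℤ² × G` and uses the square symmetry).
[cite: DuminilCopinSidoraviciusTassion2016, Thm. 1, §2.3 and p. 3 (remark "ℤ² × G, G finite")] [cite: BenjaminiSchramm1996, Conj. 4 / Question 3]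
[cite: Wierman1981, Thm.] [cite: GrimmettPercolation1999, Thm. (2.8) p. 35 and §1.6 p. 16]
-/

noncomputable section

namespace Summit.CriticalPhenomena.PercolationContinuityZ3.Theorems.Transplant

namespace FinProdTri

open MeasureTheory Literature.Probability.Percolation Literature.Probability.LatticeModels SimpleGraph
open FinProdZ2 (Fork exists_fork theta_critical_eq_of_iso)
open scoped Classical

variable {W : Type} (F : SimpleGraph W)

/-! ## §1 Every connected `F` with a fork -/

/-- **`θ_{F □ 𝕋}(v, p_c) = 0` for every finite connected `F` WITH A FORK, every vertex** — p205010-free: column-level routing by the kernel table's planar hexagonal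
claw («TriClawXLegs».`exists_claw_of_tgtCols`, every column-certified triple; the centre is no target column) and the hub template («ProdTriHubRoute».
`swapPair_of_clawProps`), then «ProdTriHexShadow».`theta_criticalProb_eq_zero_of_colRouting`.
[cite: DuminilCopinSidoraviciusTassion2016, Thm. 1, §2.3 and p. 3 (remark "ℤ² × G, G finite")] [cite: BenjaminiSchramm1996, Conj. 4 / Question 3] -/
theorem theta_criticalProb_eq_zero_of_fork [Fintype W] (hF : F.Connected) {c₀ a₀ b₀ : W} (φ : Fork F c₀ a₀ b₀) (v : W × Site 2) :
    theta (F □ triGraph) v (criticalProbIOf (F □ triGraph) v) = 0 := by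
  refine theta_criticalProb_eq_zero_of_colRouting F hF ?_ v
  intro z tR tD sR sD hRD hSE hone E₁ E₂ w' hne h1 h1R h1z h2 h2R h2z h3 h31 h32
  have hts : 3 ≤ tD ∨ 3 ≤ sD := hone.imp (fun h => h.trans hRD) (fun h => h.trans hSE)
  have h3z : sh w' ≠ z := fun h => TriClawX.centre_not_mem_tgtCols hts hone hRD hSE (h ▸ h3)
  obtain ⟨q, l1, l2, l3, hP⟩ := TriClawX.exists_claw_of_tgtCols hRD hSE hone h1 h1R h1z h2 h2R h2z h3 h3z h31 h32
  exact swapPair_of_clawProps F hF φ hne hP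

/-! ## §2 The fork-free connected graphs: one vertex (`𝕋 × {0}`) and one edge (`𝕋 × {0,1}`), through the triangular films -/

/-- **A fibre isomorphic to a path `P_{k+1}` makes `F □ 𝕋` the triangular film `𝕋 × {0..k}`**, which dies at its own critical point at every vertex for EVERY `k`
(«TriFilmZero»: Wierman, `k = 0`; «TriFilmSKFinalK1»: kernel certificate, `k = 1`; «TriFilmLinkage», `k ≥ 2` — all p205010-free).
[cite: Wierman1981, Thm.] [cite: DuminilCopinSidoraviciusTassion2016, Thm. 1] [cite: BenjaminiSchramm1996, Conj. 4 / Question 3] -/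
theorem theta_criticalProb_eq_zero_of_iso_pathGraph [Fintype W] {k : ℕ} (γ : F ≃g SimpleGraph.pathGraph (k + 1)) (v : W × Site 2) :
    theta (F □ triGraph) v (criticalProbIOf (F □ triGraph) v) = 0 := by
  have Φ : (F □ triGraph) ≃g TriFilm.film k := (boxProdIso γ (RelIso.refl _)).trans (pathProdIsoFilm k)
  rw [theta_critical_eq_of_iso Φ v]
  exact TriFilm.theta_criticalProb_eq_zero_every k _

/-- **One vertex: `F ≅ P₁`, so `F □ 𝕋` is the triangular lattice `𝕋 × {0}` and Wierman's theorem applies** (p205010-free). [cite: Wierman1981, Thm.] -/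
theorem theta_criticalProb_eq_zero_of_subsingleton [Fintype W] (hall : ∀ x y : W, x = y) (v : W × Site 2) :
    theta (F □ triGraph) v (criticalProbIOf (F □ triGraph) v) = 0 := by
  have e : W ≃ Fin 1 :=
    { toFun := fun _ => 0
      invFun := fun _ => v.1
      left_inv := fun w => hall _ _
      right_inv := fun i => Subsingleton.elim _ _ }
  have γ : F ≃g SimpleGraph.pathGraph (0 + 1) :=
    { toEquiv := e
      map_rel_iff' := by
        intro a b
        rw [SimpleGraph.pathGraph_adj]
        have hab : a = b := hall a b
        constructor
        · rintro (h | h)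
          · have := (e b).isLt; omega
          · have := (e a).isLt; omega
        · intro h; exact absurd (hab ▸ h) (SimpleGraph.irrefl _) }
  exact theta_criticalProb_eq_zero_of_iso_pathGraph F γ v

/-- **One edge: `F ≅ P₂`, so `F □ 𝕋` is the film `𝕋 × {0,1}` and the tree's kernel certificate applies** (Mathlib `pathGraph_two_eq_top`; p205010-free).
[cite: DuminilCopinSidoraviciusTassion2016, Thm. 1 (k = 1)] [cite: BenjaminiSchramm1996, Conj. 4 / Question 3] -/
theorem theta_criticalProb_eq_zero_of_pair [Fintype W] (hF : F.Connected) {x y : W} (hxy : x ≠ y) (hall : ∀ t : W, t ≠ x → t = y) (v : W × Site 2) :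
    theta (F □ triGraph) v (criticalProbIOf (F □ triGraph) v) = 0 := by
  -- the edge `x ∼ y`
  have hadj : F.Adj x y := by
    obtain ⟨w⟩ := hF.preconnected x y
    obtain ⟨d, -, hd1, hd2⟩ := w.exists_boundary_dart ({x} : Set W) (by simp) (by simp [hxy.symm])
    simp only [Set.mem_singleton_iff] at hd1 hd2
    have := d.adj
    rw [hd1, hall _ hd2] at this
    exact this
  have hadj' : ∀ a b : W, F.Adj a b ↔ a ≠ b := by
    intro a b
    refine ⟨fun h => h.ne, fun h => ?_⟩
    rcases eq_or_ne a x with rfl | ha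
    · have hb := hall b (Ne.symm h); subst hb; exact hadj
    · have ha' := hall a ha; subst ha'
      rcases eq_or_ne b x with rfl | hb
      · exact hadj.symm
      · exact absurd (hall b hb) (Ne.symm h)
  -- `F ≅ P₂`
  have e : W ≃ Fin 2 :=
    { toFun := fun w => if w = x then 0 else 1
      invFun := fun i => if i = 0 then x else y
      left_inv := fun w => by
        by_cases hw : w = x
        · simp [hw]
        · rw [hall w hw]; simp [hxy.symm]
      right_inv := fun i => by
        fin_cases i
        · simp
        · simp [hxy.symm] }
  have γ : F ≃g SimpleGraph.pathGraph (1 + 1) :=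
    { toEquiv := e
      map_rel_iff' := by
        intro a b
        rw [SimpleGraph.pathGraph_two_eq_top, SimpleGraph.top_adj, e.injective.ne_iff, hadj'] }
  exact theta_criticalProb_eq_zero_of_iso_pathGraph F γ v

/-! ## §3 The theorems -/

/-- **`θ_{F □ 𝕋}(v, p_c(F □ 𝕋)) = 0` FOR EVERY FINITE CONNECTED GRAPH `F` AND EVERY VERTEX `v` — UNCONDITIONAL, p205010-FREE.**  The triangular-lattice twin of
Duminil-Copin–Sidoravicius–Tassion's remark "the same proof works for `ℤ² × G`, `G` finite" (in print only for the square lattice, whose quarter turn their proof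
uses): the hexagonal DST transplant («HexShadow*») with the uniform routing of this generation for every `F` with a fork; Wierman (`|F| = 1`) and the film
`𝕋 × {0,1}` (`F` an edge) for the fork-free ones.
[cite: DuminilCopinSidoraviciusTassion2016, Thm. 1 and p. 3 (remark "ℤ² × G, G finite")] [cite: BenjaminiSchramm1996, Conj. 4 / Question 3] [cite: Wierman1981, Thm.] -/
theorem theta_criticalProb_eq_zero [Fintype W] (hF : F.Connected) (v : W × Site 2) : theta (F □ triGraph) v (criticalProbIOf (F □ triGraph) v) = 0 := by
  by_cases h2 : ∃ x y : W, x ≠ y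
  · obtain ⟨x, y, hxy⟩ := h2
    by_cases h3 : ∃ t : W, t ≠ x ∧ t ≠ y
    · obtain ⟨t, htx, hty⟩ := h3
      obtain ⟨c, a, b, φ⟩ := exists_fork F hF hxy htx hty
      exact theta_criticalProb_eq_zero_of_fork F hF φ v
    · push Not at h3
      exact theta_criticalProb_eq_zero_of_pair F hF hxy h3 v
  · push Not at h2
    exact theta_criticalProb_eq_zero_of_subsingleton F h2 v

/-- **The same for `𝕋 □ F` (fibre second), EVERY vertex** — by Mathlib's `boxProdComm : F □ 𝕋 ≃g 𝕋 □ F`.  p205010-free.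
[cite: DuminilCopinSidoraviciusTassion2016, Thm. 1 and p. 3] [cite: BenjaminiSchramm1996, Conj. 4] -/
theorem theta_criticalProb_eq_zero_comm [Fintype W] (hF : F.Connected) (v : Site 2 × W) :
    theta (triGraph □ F) v (criticalProbIOf (triGraph □ F) v) = 0 := by
  have h := theta_criticalProb_eq_zero F hF ((SimpleGraph.boxProdComm triGraph F) v)
  rwa [← theta_critical_eq_of_iso (SimpleGraph.boxProdComm triGraph F) v] at h

/-- **van den Berg–Keane phrasing: `p ↦ θ_{F □ 𝕋}(v, p)` is CONTINUOUS on `[0, 1]`** for every finite connected `F` and every vertex (uniqueness at every density by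
Burton–Keane, «ProdTriHexShadow»; the tree's criterion `continuous_theta_iff_of_unique`). p205010-free. [cite: VandenBergKeane1984, Theorem]
[cite: DuminilCopinSidoraviciusTassion2016, Thm. 1 and p. 3] -/
theorem continuous_theta [Fintype W] [DecidableEq W] [DecidableRel F.Adj] (hF : F.Connected) (v : W × Site 2) :
    Continuous fun p : unitInterval => theta (F □ triGraph) v p :=
  (VdBK.continuous_theta_iff_of_unique (F □ triGraph) v fun p _ => numInfiniteClusters_le_one F hF p).2 (theta_criticalProb_eq_zero F hF v)

/-! ## §4 Named fibres: triangular slabs, cylinders, complete fibres, doubly-thin slabs of `𝕋 □ ℤ²` -/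

/-- **Triangular slabs `𝕋 × {0,…,k}` (`F = P_{k+1}`), every vertex, p205010-free** — by name the tree's `TriFilm.theta_criticalProb_eq_zero_every` (through
«ProdTriFilmIso»), here re-obtained for `k ≥ 2` by the uniform routing as well. [cite: DuminilCopinSidoraviciusTassion2016, Thm. 1] [cite: BenjaminiSchramm1996, Conj. 4] -/
theorem theta_criticalProb_eq_zero_pathGraph (k : ℕ) (v : Fin (k + 1) × Site 2) :
    theta (SimpleGraph.pathGraph (k + 1) □ triGraph) v (criticalProbIOf (SimpleGraph.pathGraph (k + 1) □ triGraph) v) = 0 :=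
  theta_criticalProb_eq_zero _ (SimpleGraph.pathGraph_connected k) v

/-- **Cylindrical triangular slabs `𝕋 × C_n` (`F` the cycle graph), every vertex, p205010-free.** [cite: BenjaminiSchramm1996, Conj. 4 / Question 3] -/
theorem theta_criticalProb_eq_zero_cycleGraph (n : ℕ) (v : Fin (n + 1) × Site 2) :
    theta (SimpleGraph.cycleGraph (n + 1) □ triGraph) v (criticalProbIOf (SimpleGraph.cycleGraph (n + 1) □ triGraph) v) = 0 :=
  theta_criticalProb_eq_zero _ SimpleGraph.cycleGraph_connected v

/-- **`𝕋 × K_W` (`F` the complete graph on a non-empty finite type), every vertex, p205010-free.** [cite: BenjaminiSchramm1996, Conj. 4 / Question 3] -/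
theorem theta_criticalProb_eq_zero_completeGraph [Fintype W] [Nonempty W] (v : W × Site 2) :
    theta ((⊤ : SimpleGraph W) □ triGraph) v (criticalProbIOf ((⊤ : SimpleGraph W) □ triGraph) v) = 0 :=
  theta_criticalProb_eq_zero _ SimpleGraph.connected_top v

/-- **Doubly-thin slabs `𝕋 × {0,…,a} × {0,…,b}` of `𝕋 □ ℤ²` (`F = P_{a+1} □ P_{b+1}`), every vertex, p205010-free.** [cite: BenjaminiSchramm1996, Conj. 4 / Question 3] -/
theorem theta_criticalProb_eq_zero_pathGraph_boxProd (a b : ℕ) (v : (Fin (a + 1) × Fin (b + 1)) × Site 2) :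
    theta ((SimpleGraph.pathGraph (a + 1) □ SimpleGraph.pathGraph (b + 1)) □ triGraph) v
      (criticalProbIOf ((SimpleGraph.pathGraph (a + 1) □ SimpleGraph.pathGraph (b + 1)) □ triGraph) v) = 0 :=
  theta_criticalProb_eq_zero _ ((SimpleGraph.pathGraph_connected a).boxProd (SimpleGraph.pathGraph_connected b)) v

end FinProdTri

end Summit.CriticalPhenomena.PercolationContinuityZ3.Theorems.Transplant

end
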